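import Summits.BirchSwinnertonDyer.BirchSwinnertonDyer.Theorems.KimAtThreeShallowEqDeepOffStratumAdditiveDefect
import Summits.BirchSwinnertonDyer.BirchSwinnertonDyer.Theorems.KimAtThreeDeepUpperOffStratumPortE
import HarnessLib

/-!
# Route `KimAtThreeKolyvagin` (rung W2), crux `ShallowEqDeepOffKatoStratum` (item 19599): the registered stub
# `stub_additiveDefect` ⟸ PORT₂-SHARED ALONE (+ the four PUBLISHED facts) — the upper twin supplied by acc1's port road

Cell `bsd-addord`, seat `bsd-addord-w2-acc6` (PROGRAMME PART 1b, plan g16 ACCEL-LIST (6)); `--supports` 19599 (helper; the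
item OWNER assembles via `Cruxes.ShallowEqDeepOffKatoStratum.Birth.ShallowEqDeepOffKatoStratum_of`).  Theorems only (no
definition, no named fact, no `sorry`); nothing asserted, nothing booked; crux 19599 stays OPEN.  Sequel of
`KimAtThreeShallowEqDeepOffStratumAdditiveDefect` (`stub_additiveDefect_of_portTwoExp_of_upperRow`: the stub ⟸ PORT₂-SHARED +
19562's registered defect stub + PUB).

WHAT.  The UPPER twin at an additive-defect row is itself a consequence of PORT₂: seat acc1's
`KimAtThreeDeepUpperOffStratumPortE.deepUpper_conclusion_of_port_e` (p458865) proves cruxes 19076/19562 at ANY tower row with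
`L(E,1) ≠ 0` from [S24] (1)(2), GZK, the Poitou–Tate families and ONE single-depth port «∀ k, ∀ τ-datum `Dk` canonical for
`η`, ∃ κ Λ κ′, `KatoKuriharaWitnessAt W k e Dk v₃ D κ Λ κ′`» with a free exponent `e`; and PORT₂
(`KatoKuriharaPortThreeAtWith₂TwoExp W 0 e v₃ η D`, `KimAtThreeKolyvaginDefs`) supplies that port at exponent `0`: take the
shallow triple of the two-exponent dictionary at `(k, k)` and scale Kato's families by `3^e`
(`KimAtThreeShallowEqDeepOffStratumAdditiveDefect.katoKuriharaWitnessAt_smul_of_witnessAtTwoExp`) — `portE_zero_of_portTwoExp`.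
Hence `shallowEqDeepOff_row_additive_of_portTwoExp` (the row, NO twin hypothesis) and **`stub_additiveDefect_of_portTwoExp`**:
TYPE = the registered 19599 stub VERBATIM, GRANTED [S24] (1)(2), GZK, Poitou–Tate BY NAME and ONE displayed hypothesis
`hPort₂` = PORT₂-SHARED on the additive-defect rows (crux 19560's `KatoKuriharaPortThreeShared` shape with `3 ∣ c₃ ∨ 3 ∣ c_P`
in place of its negation, `∃ e`; FLAG `K22-Thm3.13-PORT@3`; NOT in print at `3`) — ONE residual object for these rows.
References: [Kim2022StructureSelmer] Thm. 1.9 (6), Thm. 3.13; [Kim2025RefinedTNC] Thm 1.1, Thm 1.2, §8.1.2; [Sakamoto2024]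
Thm. 4.4; [MazurRubin2004] Thm. 3.2.4, 4.4.1, 5.2.12, App. A (33); [MilneADT2006] I Thm. 4.10.
-/

set_option autoImplicit false
-- the Theorems namespace of a single-conjunct summit repeats the summit name by design (D-0017)
set_option linter.dupNamespace false

noncomputable section

open scoped Classical NumberField ContRepresentation
open Function Field NumberField IsDedekindDomain IsDedekindDomain.HeightOneSpectrum WeierstrassCurve
  CongruenceSubgroup
  Literature.NumberTheory.EllipticCurves Literature.NumberTheory.EllipticCurves.ModularForms
  Literature.NumberTheory.EllipticCurves.Rank1Residual
  Literature.NumberTheory.GaloisRepresentations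
  Literature.NumberTheory.GaloisRepresentations.DiscreteGaloisModule Literature.NumberTheory.GaloisCohomology
  Rat.HeightOneSpectrum
  Summit.BirchSwinnertonDyer.Rank1Residual.GaloisImage
  Summit.BirchSwinnertonDyer.Rank1Residual.GaloisImage.Assembly
  Summit.BirchSwinnertonDyer.Rank1Residual.X4

namespace Summit.BirchSwinnertonDyer.BirchSwinnertonDyer.Theorems.KimAtThreeShallowEqDeepOffStratumAdditiveDefectOfPort

open Summit.BirchSwinnertonDyer.BirchSwinnertonDyer.Theorems.KimAtThreeKolyvaginDefs
  Summit.BirchSwinnertonDyer.BirchSwinnertonDyer.Theorems.KimAtThreeTwoExponentTower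
  Summit.BirchSwinnertonDyer.BirchSwinnertonDyer.Theorems.KimAtThreeShallowEqDeepOffStratumAdditiveDefect
  Summit.BirchSwinnertonDyer.BirchSwinnertonDyer.Theorems.KimAtThreeShallowEqDeepOffStratumSockets
  Summit.BirchSwinnertonDyer.BirchSwinnertonDyer.Theorems.KimAtThreeDeepLowerKatoStratumOfFacts
  Summit.BirchSwinnertonDyer.BirchSwinnertonDyer.Theorems.KimAtThreeShallowEqDeepSplitGlueNoStub
  Summit.BirchSwinnertonDyer.BirchSwinnertonDyer.Theorems.KimAtThreeDeepUpperOffStratumPortE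
  Summit.BirchSwinnertonDyer.BirchSwinnertonDyer.Theorems.KimAtThreeKolyvaginUnitLevelOneRungs

/-- **PORT₂ at `t = 0` feeds acc1's single-depth port at exponent `0`**: on an additive row with `E(ℚ₃)[3] = 0`,
`KatoKuriharaPortThreeAtWith₂TwoExp W 0 e v₃ η D` gives, at every depth `k` and every `τ`-datum `Dk` canonical for
`η`, witnesses of n1011's `KatoKuriharaWitnessAt W k 0 Dk v₃ D` (the shallow triple of the dictionary at `(k, k)`,
scaled by `3^e`) — the hypothesis `hPort` of acc1's `KimAtThreeDeepUpperOffStratumPortE.deepUpper_conclusion_of_port_e`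
at `e = 0`. [cite: Kim2022StructureSelmer, Thm. 3.13 (arXiv p. 17)] [cite: MazurRubin2004, Thm. 3.2.4 and App. A (33)] -/
theorem portE_zero_of_portTwoExp
    (W : WeierstrassCurve ℚ) [W.IsElliptic] [W.IsGloballyMinimal]
    (hadd : haveI : Fact (Nat.Prime 3) := ⟨Nat.prime_three⟩; Addv W 3)
    (htower : ∀ m : ℕ, W.HasSurjectiveModNGaloisRep (3 ^ m : ℕ))
    (ht0 : Nat.card {Q : (W.baseChange ℚ_[3]).toAffine.Point // (3 : ℕ) • Q = 0} = 1)
    {N : ℕ} [NeZero N] (D : ModularParametrizationData W N) (e : ℕ)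
    (v₃ : HeightOneSpectrum (𝓞 ℚ)) (hv₃ : ((3 : ℕ) : 𝓞 ℚ) ∈ v₃.asIdeal)
    (η : (q : HeightOneSpectrum (𝓞 ℚ)) → (ZMod (Ideal.absNorm q.asIdeal))ˣ)
    (hPort : KatoKuriharaPortThreeAtWith₂TwoExp W 0 e v₃ η D) :
    ∀ (k : ℕ) (Dk : KolyvaginDatum (W.torsionGaloisModule (((3 : ℕ) : ℤ) ^ k * ((3 : ℕ) : ℤ)))),
      Dk.IsCanonicalTauDatumThreeAtWith W k k η →
      ∃ (κ : Finset (HeightOneSpectrum (𝓞 ℚ)) →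
            galoisCohomology (W.torsionGaloisModule (((3 : ℕ) : ℤ) ^ k * ((3 : ℕ) : ℤ))) 1)
        (Λ : galoisCohomology ((W.torsionGaloisModule (((3 : ℕ) : ℤ) ^ k * ((3 : ℕ) : ℤ))).toLocal
            (Sum.inr v₃)) 1 →+ ZMod (3 ^ (k + 1)))
        (κ' : Finset (HeightOneSpectrum (𝓞 ℚ)) →
            galoisCohomology (W.torsionGaloisModule (((3 : ℕ) : ℤ) ^ k * ((3 : ℕ) : ℤ))) 1),
        KatoKuriharaWitnessAt W k 0 Dk v₃ D κ Λ κ' := by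
  haveI : Fact (Nat.Prime 3) := ⟨Nat.prime_three⟩
  intro k Dk hDk
  have hsurj : W.HasSurjectiveModNGaloisRep ((3 : ℕ) : ℤ) := by simpa using htower 1
  obtain ⟨red, hred⟩ := exists_torsionReduction_three W k k
  have hDk' : Dk.IsCanonicalTauDatumThreeAtWith W (k + 0) k η := by simpa using hDk
  obtain ⟨κ, Λ, κ', -, -, -, hW, -, -⟩ :=
    hPort k k Dk Dk red hDk' hDk' le_rfl hred hadd hsurj (by rw [ht0, pow_zero]) hv₃
  exact ⟨_, Λ, _, katoKuriharaWitnessAt_smul_of_witnessAtTwoExp W k 0 e Dk v₃ D κ Λ κ' hW⟩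

/-- **Crux 19599 at ONE additive-defect row from the two-exponent port ALONE** (GRANTED [S24] (1)(2), GZK,
Poitou–Tate by name): the UPPER twin at the row is itself a consequence of the port — acc1's
`KimAtThreeDeepUpperOffStratumPortE.deepUpper_conclusion_of_port_e` (19076/19562 at any tower row from the single-depth
free-exponent port) fed by `portE_zero_of_portTwoExp` — so `∂^{(∞)}_deep(δ̃) ≤ ∂^{(∞)}(δ̃)` on the row needs NO
twin hypothesis. [cite: Kim2025RefinedTNC, Thm 1.1, Thm 1.2 and §8.1.2] [cite: Kim2022StructureSelmer, Thm. 1.9 (6), §1.5.1]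
[cite: MazurRubin2004, Thm. 4.4.1 and Thm. 5.2.12] [cite: Sakamoto2024, Thm. 4.4 (p. 926)] [cite: MilneADT2006, Ch. I, Thm. 4.10] -/
theorem shallowEqDeepOff_row_additive_of_portTwoExp
    (hS24 : Sakamoto2024.kolyvaginSystems_freeRankOne_zmod_three_pow)
    (hS24₂ : Sakamoto2024.kolyvaginSystems_idealOfBasis_eq_fittingIdeal_zmod_three_pow)
    (hGZK : rank_eq_analyticRank_of_analyticRank_le_one)
    (hPT : poitouTate_selmerStructure_duality ℚ)
    (W : WeierstrassCurve ℚ) [W.IsElliptic] [W.IsGloballyMinimal]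
    (hadd : haveI : Fact (Nat.Prime 3) := ⟨Nat.prime_three⟩; Addv W 3)
    (htower : ∀ m : ℕ, W.HasSurjectiveModNGaloisRep (3 ^ m : ℕ))
    (ht0 : Nat.card {Q : (W.baseChange ℚ_[3]).toAffine.Point // (3 : ℕ) • Q = 0} = 1)
    {N : ℕ} [NeZero N] (hN : N = W.conductorNorm ℤ) (D : ModularParametrizationData W N) (e : ℕ)
    (hint : ∀ r : ℚ, ratPlusSymbol D.f r ≠ 0 → 0 ≤ padicValRat 3 (ratPlusSymbol D.f r))
    (v₃ : HeightOneSpectrum (𝓞 ℚ)) (hv₃ : ((3 : ℕ) : 𝓞 ℚ) ∈ v₃.asIdeal)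
    (η : (q : HeightOneSpectrum (𝓞 ℚ)) → (ZMod (Ideal.absNorm q.asIdeal))ˣ)
    (hη : ∀ q : HeightOneSpectrum (𝓞 ℚ), Subgroup.zpowers (η q) = ⊤)
    (hPort : KatoKuriharaPortThreeAtWith₂TwoExp W 0 e v₃ η D)
    (hord : kuriharaVanishingOrder W 3 D.f = 0) :
    kuriharaPartialDeepInfty W 3 D.f ≤ kuriharaPartialInfty W 3 D.f := by
  haveI : Fact (Nat.Prime 3) := ⟨Nat.prime_three⟩
  have h0 : ratPlusSymbol D.f 0 ≠ 0 :=
    ratPlusSymbol_zero_ne_zero_of_kuriharaVanishingOrder_eq_zero W 3 D.f hord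
  have hL : W.entireLFunction 1 ≠ 0 :=
    D.isNewformOf.entireLFunction_one_ne_zero_of_ratPlusSymbol_zero_ne_zero h0
  obtain ⟨inv, hperf, hsum, -, hcompl⟩ := hPT 3
  obtain ⟨inv', hperf', hsum', hcompl', hinj'⟩ := exists_localInvariants_three_pow_of_poitouTate hPT
  have hU := deepUpper_conclusion_of_port_e hS24 hS24₂ hGZK W htower hL D hint inv hperf hsum hcompl inv' hperf'
    hsum' hcompl' hinj' v₃ hv₃ η hη 0 (portE_zero_of_portTwoExp W hadd htower ht0 D e v₃ hv₃ η hPort)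
  exact shallowEqDeepOff_row_additive_of_portTwoExp_of_upperRow hS24 hS24₂ hGZK hPT W hadd htower ht0 hN D e v₃ hv₃
    η hη hPort hord hU

/-- **The registered stub `stub_additiveDefect` of crux 19599 ⟸ ONE displayed named hypothesis, PORT₂-SHARED**
(besides the four PUBLISHED facts [S24] (1)(2), GZK, Poitou–Tate by name): the UPPER twin is no longer displayed —
it follows from the same port through acc1's `deepUpper_conclusion_of_port_e` (`shallowEqDeepOff_row_additive_of_portTwoExp`).
`hPort₂` = the two-exponent shared-generator Kato–Kurihara closure `KatoKuriharaPortThreeAtWith₂TwoExp W 0 e v₃ η P`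
(SOME `e`; in print `e = v₃(c₃) + v₃(c_P)`) on every additive-defect row — crux 19560's `KatoKuriharaPortThreeShared`
shape with the defect (`3 ∣ c₃ ∨ 3 ∣ c_P`) in place of its negation; FLAG `K22-Thm3.13-PORT@3`; the residual OBJECT
of these rows.  TYPE of the conclusion = the 19599 stub VERBATIM (for the OWNER's `ShallowEqDeepOffKatoStratum_of`).
[cite: Kim2025RefinedTNC, Thm 1.1, Thm 1.2 and §8.1.2] [cite: Kim2022StructureSelmer, Thm. 1.9 (6) and Thm. 3.13]
[cite: MazurRubin2004, Thm. 5.2.12] [cite: Sakamoto2024, Thm. 4.4 (p. 926)] [cite: MilneADT2006, Ch. I, Thm. 4.10] -/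
theorem stub_additiveDefect_of_portTwoExp
    (hS24 : Sakamoto2024.kolyvaginSystems_freeRankOne_zmod_three_pow)
    (hS24₂ : Sakamoto2024.kolyvaginSystems_idealOfBasis_eq_fittingIdeal_zmod_three_pow)
    (hGZK : rank_eq_analyticRank_of_analyticRank_le_one)
    (hPT : poitouTate_selmerStructure_duality ℚ)
    (hPort₂ : ∀ (W : WeierstrassCurve ℚ) [W.IsElliptic] [W.IsGloballyMinimal],
      (∀ m : ℕ, W.HasSurjectiveModNGaloisRep (3 ^ m : ℕ)) →
      (haveI : Fact (Nat.Prime 3) := ⟨Nat.prime_three⟩; Addv W 3) →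
      Nat.card {Q : (W.baseChange ℚ_[3]).toAffine.Point // (3 : ℕ) • Q = 0} = 1 →
      ∀ (v₃ : HeightOneSpectrum (𝓞 ℚ)), ((3 : ℕ) : 𝓞 ℚ) ∈ v₃.asIdeal →
      ∀ (η : (q : HeightOneSpectrum (𝓞 ℚ)) → (ZMod (Ideal.absNorm q.asIdeal))ˣ),
        (∀ q, Subgroup.zpowers (η q) = ⊤) →
      ∀ {N : ℕ} [NeZero N] (P : ModularParametrizationData W N), N = W.conductorNorm ℤ →
        (∀ z ∈ P.L.lattice, ∃ w ∈ periodLattice P.f, z = P.c * w) →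
        (3 ∣ (W.baseChange ℚ_[3]).localTamagawaNumber ℤ_[3] ∨ (3 : ℤ) ∣ P.maninConstant) →
          ∃ e : ℕ, KatoKuriharaPortThreeAtWith₂TwoExp W 0 e v₃ η P) :
    ∀ (W₀ : WeierstrassCurve ℚ) [W₀.IsElliptic] [W₀.IsGloballyMinimal],
      (∀ n : ℕ, W₀.HasSurjectiveModNGaloisRep (3 ^ n : ℕ)) →
      Nat.card {Q : (W₀.baseChange ℚ_[3]).toAffine.Point // (3 : ℕ) • Q = 0} = 1 → Finite W₀.sha →
      ∀ {N : ℕ} [NeZero N], N = W₀.conductorNorm ℤ →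
      ∀ (D₀ : Literature.NumberTheory.EllipticCurves.ModularForms.ModularParametrizationData W₀ N),
        (∀ z ∈ D₀.L.lattice, ∃ w ∈ Literature.NumberTheory.EllipticCurves.ModularForms.periodLattice D₀.f, z = D₀.c * w) →
        (∀ (W₂ : WeierstrassCurve ℚ) [W₂.IsElliptic]
          (D₂ : Literature.NumberTheory.EllipticCurves.ModularForms.ModularParametrizationData W₂ N),
          D₂.f = D₀.f → D₀.modularDegree ≤ D₂.modularDegree) →
        (∀ r : ℚ, Literature.NumberTheory.EllipticCurves.ratPlusSymbol D₀.f r ≠ 0 →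
          0 ≤ padicValRat 3 (Literature.NumberTheory.EllipticCurves.ratPlusSymbol D₀.f r)) →
        Literature.NumberTheory.EllipticCurves.kuriharaVanishingOrder W₀ 3 D₀.f = 0 →
        (haveI : Fact (Nat.Prime 3) := ⟨Nat.prime_three⟩;
            Literature.NumberTheory.EllipticCurves.Rank1Residual.Addv W₀ 3) →
        (3 ∣ (W₀.baseChange ℚ_[3]).localTamagawaNumber ℤ_[3] ∨ (3 : ℤ) ∣ D₀.maninConstant) →
        Literature.NumberTheory.EllipticCurves.kuriharaPartialDeepInfty W₀ 3 D₀.f ≤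
          Literature.NumberTheory.EllipticCurves.kuriharaPartialInfty W₀ 3 D₀.f := by
  intro W₀ _ _ htow ht _hfin N _ hN D₀ hopt _hdeg hint hord hA hdef
  haveI : Fact (Nat.Prime 3) := ⟨Nat.prime_three⟩
  obtain ⟨v₃, η, hv₃, hη⟩ := exists_place_three_and_generators
  obtain ⟨e, hPort⟩ := hPort₂ W₀ htow hA ht v₃ hv₃ η hη D₀ hN hopt hdef
  exact shallowEqDeepOff_row_additive_of_portTwoExp hS24 hS24₂ hGZK hPT W₀ hA htow ht hN D₀ e hint v₃ hv₃ η hη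
    hPort hord

end Summit.BirchSwinnertonDyer.BirchSwinnertonDyer.Theorems.KimAtThreeShallowEqDeepOffStratumAdditiveDefectOfPort

end
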